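import Summits.Schanuel.Schanuel.Theorems.SoloInformedHalfDensityGraphLemmas

/-!
# The exact form of `(C_θ)` holds for every `θ > 1/2` (given Freiman's lemma, Stanchescu's theorem)

Third file on the seat's density-`θ` rigidity statement `(C_θ)` in its *exact* form (functions with
no violated additive coincidence).  `SoloInformedHalfDensityNoAffineRigidity` shows that the exact
form fails for every `θ ≤ 1/2`; `SoloInformedTwoThirdsDensityAffinePiece` proves it for every
`θ > 2/3` by elementary counting and records the window `(1/2, 2/3]` as open.  This file closes the
window conditionally on two published theorems of additive combinatorics which are not in Mathlib;
they enter as the explicit hypotheses `hFreiman` and `hStanchescu` of the main theorem (nothing is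
postulated: the file introduces no definitions and no axioms).  The preparatory lemmas live in the
imported companion file `SoloInformedHalfDensityGraphLemmas`.

* `hFreiman` — **Freiman's lemma** (G. A. Freiman, *Foundations of a structural theory of set
  addition*, Transl. Math. Monogr. 37, AMS (1973); [cite: TaoVu2006, Lemma 5.13, p. 229]): a finite
  `A ⊂ ℝⁿ` not contained in an affine subspace of dimension `< d`, `1 ≤ d` (encoded as
  `d ≤ finrank ℝ (vectorSpan ℝ A)`), has `|A + A| ≥ (d + 1)|A| - d(d + 1)/2`.
* `hStanchescu` — **Stanchescu's theorem** (Y. Stanchescu, *On the structure of sets with small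
  doubling property on the plane (I)*, Acta Arith. 83 (1998) 127–141, Theorem A, p. 128; the case
  `s = 2` is Freiman's `10/3`-theorem, Freiman 1973, p. 28): for every integer `s > 1` there is
  `k₀(s)` (effective, `k₀(s) = 16(s - 1)s(2s - 1)` by Remark (2.25), p. 135; left unspecified here)
  such that every finite `K ⊂ ℤ²` with `|K| ≥ k₀(s)` and `|K + K| < (4 - 2/s)|K| - (2s - 1)` is
  covered by `s - 1` parallel lines.  "Covered by `s - 1` parallel lines" is encoded as: for some
  real `d ≠ 0` the linear form `p ↦ d₁ p₂ - d₂ p₁` takes at most `s - 1` values on `K` (lines of the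
  real plane, as the theorem asserts; a rational direction would be a stronger hypothesis).

Main result `soloFS_exact_CTheta_of_gt_half`: granted these two facts, for every `θ > 1/2` there
are `c₀ > 0` and `K₀` such that for all `K ≥ K₀`, every `S ⊆ [1, K]` with `#S ≥ θ K` and every
`φ : ℕ → ℂ` with no violated additive coincidence on `S` (`φ (a + u) - φ a = φ (b + u) - φ b`
whenever `a, b, a + u, b + u ∈ S`) is affine, `φ s = γ + s μ`, on some `T ⊆ S` with `#T ≥ c₀ K`.
Explicitly `c₀ = θ / (s - 1)` with `s = ⌊θ / (2θ - 1)⌋ + 2`, and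
`K₀ = ⌈k₀(s)/θ⌉ + ⌈2s/ε⌉ + ⌈3/(2θ - 1)⌉ + 1` with `ε = (4 - 2/s) θ - 2 > 0`.  Together with the
refutation for `θ ≤ 1/2` in `SoloInformedHalfDensityNoAffineRigidity` this determines the
threshold of the exact form of `(C_θ)`: it is `1/2` (conditionally on the two facts).  The robust
form of `(C_θ)` (up to `η₀ K³` violated coincidences) is not addressed and remains open on the whole
range `θ > 1/2`.

Proof.  Exactness says that `φ` is a Freiman `2`-homomorphism on `S` (`soloFS_sum_eq_of_exact`),
so the graph map `g : n ↦ (n, φ n) ∈ ℚ × ℂ` satisfies `g a + g b = g c + g d` whenever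
`a + b = c + d` in `S`; hence `Y = g(S) - g(s₀) ∋ 0` has `#Y = #S` and
`#(Y + Y) ≤ #(S + S) ≤ 2K - 1` (`soloFS_card_image_add_image_le`, `soloFS_card_add_self_le`).
Let `r` be the dimension of the `ℚ`-span of `Y`.  (i) `r ≥ 3` is impossible: transporting `Y`
to `ℝ^r` by coordinates in a basis (`soloFS_rank_three_bound`), Freiman's lemma with `d = 3`
gives `4 #S ≤ #(S + S) + 6 ≤ 2K + 5`, contradicting `#S ≥ θ K` once `(2θ - 1) K > 3`.
(ii) `r ≤ 1`: the graph is contained in a line and `φ` is affine on all of `S`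
(`soloFS_affine_of_param`).  (iii) `r = 2`: clearing denominators in a basis of the span gives
integer coordinates `z : S → ℤ²` which still respect additive coincidences
(`soloFS_plane_coords`), so `B = z(S)` has `#B = #S ≥ θ K ≥ k₀(s)` and
`#(B + B) ≤ 2K - 1 < (4 - 2/s) #B - (2s - 1)` for `K` large, the last inequality because
`(4 - 2/s) θ = 2 + ε` with `ε > 0` exactly when `s > θ/(2θ - 1)`.  Stanchescu's theorem covers
`B` by `s - 1` parallel lines; one of them carries at least `#S/(s - 1)` points (pigeonhole,
`Finset.exists_le_card_fiber_of_nsmul_le_card_of_maps_to`), and on the corresponding `T ⊆ S`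
the graph is contained in a line (`soloFS_param_of_level`, via the lattice-point lemmas
`soloFS_cross_eq_of_level`, `soloFS_param_of_cross_eq`), so `φ` is affine on `T`.

Sharpness of the shape.  Let `m = 2r - 1` and `S = {1 ≤ n ≤ K : n mod m < r}` (density `→ r/m`,
which `↓ 1/2` as `r → ∞`).  The function `φ n = (n mod m)` has no violated additive coincidence on
`S`: residues of elements of `S` lie in `[0, r)`, so for `a, a + u ∈ S` the difference
`((a + u) mod m) - (a mod m)` lies in `(-r, r)` and is `≡ u (mod m)`, hence it is the unique such
representative of `u`, independent of `a`.  An affine piece of this `φ` lies in one residue class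
or has at most `r` elements.  So for `θ < r/(2r - 1)` every admissible constant has
`c₀(θ) ≤ 1/(2r - 1)`, i.e. `c₀(θ) = O(2θ - 1)` is necessary; the constant `θ/(s - 1)` obtained
here is of the same order (as `θ ↑ r/(2r - 1)` it tends to `r/((r + 1)(2r - 1))`).  Stanchescu's
Example A (p. 135) shows that his doubling bound cannot be raised.  All of this is the classical
picture "very small doubling in a torsion-free group ⇒ few parallel lines" (Freiman 1966/1973,
Stanchescu 1998; cf. [cite: TaoVu2006, §5.3]); no novelty is claimed beyond the bookkeeping.
Role: closes, conditionally, the recorded window `(1/2, 2/3]` of the toy layer of this seat (node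
`RoyAdditiveDirichletExponent`); audit class `proof.conditional` (two displayed literature
hypotheses); it introduces no definitions.
-/


namespace Summit.Schanuel.Schanuel.Theorems

open Finset
open scoped Pointwise

/-! ### Collinear lattice points -/

/-- Three lattice points on a common real line `{q : d₁ q₂ - d₂ q₁ = const}` (`d ≠ 0`) satisfy the
integer collinearity relation. -/
theorem soloFS_cross_eq_of_level {d : ℝ × ℝ} (hd : d ≠ 0) {P Q R : ℤ × ℤ}
    (hQ : d.1 * (Q.2 : ℝ) - d.2 * (Q.1 : ℝ) = d.1 * (P.2 : ℝ) - d.2 * (P.1 : ℝ))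
    (hR : d.1 * (R.2 : ℝ) - d.2 * (R.1 : ℝ) = d.1 * (P.2 : ℝ) - d.2 * (P.1 : ℝ)) :
    (Q.1 - P.1) * (R.2 - P.2) = (Q.2 - P.2) * (R.1 - P.1) := by
  have goalR : ((Q.1 : ℝ) - P.1) * ((R.2 : ℝ) - P.2) = ((Q.2 : ℝ) - P.2) * ((R.1 : ℝ) - P.1) := by
    by_cases h1 : d.1 = 0
    · have h2 : d.2 ≠ 0 := by
        intro h2; exact hd (Prod.ext h1 h2)
      have hQ1 : (Q.1 : ℝ) = P.1 := by
        have : d.2 * ((Q.1 : ℝ) - P.1) = 0 := by rw [h1] at hQ; linarith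
        rcases mul_eq_zero.mp this with h | h
        · exact (h2 h).elim
        · linarith
      have hR1 : (R.1 : ℝ) = P.1 := by
        have : d.2 * ((R.1 : ℝ) - P.1) = 0 := by rw [h1] at hR; linarith
        rcases mul_eq_zero.mp this with h | h
        · exact (h2 h).elim
        · linarith
      rw [hQ1, hR1]; ring
    · have key : d.1 * (((Q.1 : ℝ) - P.1) * ((R.2 : ℝ) - P.2)
          - ((Q.2 : ℝ) - P.2) * ((R.1 : ℝ) - P.1)) = 0 := by
        linear_combination ((Q.1 : ℝ) - P.1) * hR - ((R.1 : ℝ) - P.1) * hQ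
      rcases mul_eq_zero.mp key with h | h
      · exact (h1 h).elim
      · linarith
  exact_mod_cast goalR

/-- The integer collinearity relation with `P ≠ Q` gives a rational parameter:
`R - P = t (Q - P)`. -/
theorem soloFS_param_of_cross_eq {P Q R : ℤ × ℤ} (hPQ : Q ≠ P)
    (h : (Q.1 - P.1) * (R.2 - P.2) = (Q.2 - P.2) * (R.1 - P.1)) :
    ∃ t : ℚ, ((R.1 : ℚ) - P.1 = t * ((Q.1 : ℚ) - P.1)) ∧
      ((R.2 : ℚ) - P.2 = t * ((Q.2 : ℚ) - P.2)) := by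
  have hQ : ((Q.1 : ℚ) - P.1) * ((R.2 : ℚ) - P.2) = ((Q.2 : ℚ) - P.2) * ((R.1 : ℚ) - P.1) := by
    exact_mod_cast h
  by_cases h1 : Q.1 = P.1
  · have h2 : (Q.2 : ℚ) - P.2 ≠ 0 := by
      intro h2
      apply hPQ
      refine Prod.ext h1 ?_
      exact_mod_cast (sub_eq_zero.mp h2)
    have hR1 : (R.1 : ℚ) - P.1 = 0 := by
      have h1' : (Q.1 : ℚ) - P.1 = 0 := by exact_mod_cast (sub_eq_zero.mpr h1)
      rw [h1', zero_mul] at hQ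
      rcases mul_eq_zero.mp hQ.symm with h | h
      · exact (h2 h).elim
      · exact h
    refine ⟨((R.2 : ℚ) - P.2) / ((Q.2 : ℚ) - P.2), ?_, ?_⟩
    · have h1' : (Q.1 : ℚ) - P.1 = 0 := by exact_mod_cast (sub_eq_zero.mpr h1)
      rw [hR1, h1', mul_zero]
    · rw [div_mul_cancel₀ _ h2]
  · have h1' : (Q.1 : ℚ) - P.1 ≠ 0 := by
      intro h; apply h1; exact_mod_cast (sub_eq_zero.mp h)
    refine ⟨((R.1 : ℚ) - P.1) / ((Q.1 : ℚ) - P.1), ?_, ?_⟩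
    · rw [div_mul_cancel₀ _ h1']
    · rw [div_mul_eq_mul_div, eq_div_iff h1']
      linear_combination hQ

/-! ### From a level set of a linear form to a rational parametrisation -/

/-- **Points on one line.**  If the points `G a` (`a ∈ T`) have integer coordinates `z a` all
lying on one real line `{q : d₁ q₂ - d₂ q₁ = const}` (`d ≠ 0`), then they admit a rational
parametrisation `G a = c + t • u`. -/
theorem soloFS_param_of_level {ι W : Type*} [AddCommGroup W] [Module ℚ W]
    (T : Finset ι) (G : ι → W) (z : ι → ℤ × ℤ) (w₀ w₁ : W)
    (hdec : ∀ a ∈ T, G a = ((z a).1 : ℚ) • w₀ + ((z a).2 : ℚ) • w₁)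
    {d : ℝ × ℝ} (hd : d ≠ 0)
    (hlevel : ∀ a ∈ T, ∀ a' ∈ T,
      d.1 * ((z a).2 : ℝ) - d.2 * ((z a).1 : ℝ) = d.1 * ((z a').2 : ℝ) - d.2 * ((z a').1 : ℝ)) :
    ∃ c u : W, ∀ a ∈ T, ∃ t : ℚ, G a = c + t • u := by
  rcases T.eq_empty_or_nonempty with hT | ⟨p, hp⟩
  · exact ⟨0, 0, by simp [hT]⟩
  by_cases hq : ∃ q ∈ T, z q ≠ z p
  · obtain ⟨q, hq, hzq⟩ := hq
    refine ⟨G p, G q - G p, fun a ha => ?_⟩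
    have hcross := soloFS_cross_eq_of_level hd (hlevel q hq p hp) (hlevel a ha p hp)
    obtain ⟨t, h1, h2⟩ := soloFS_param_of_cross_eq hzq hcross
    refine ⟨t, ?_⟩
    have e1 : ((z a).1 : ℚ) = (z p).1 + t * ((z q).1 - (z p).1) := by linarith
    have e2 : ((z a).2 : ℚ) = (z p).2 + t * ((z q).2 - (z p).2) := by linarith
    rw [hdec a ha, hdec p hp, hdec q hq, e1, e2]
    module
  · push Not at hq
    refine ⟨G p, 0, fun a ha => ⟨0, ?_⟩⟩
    rw [hdec a ha, hdec p hp, hq a ha]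
    simp


/-! ### The exact form of `(C_θ)` above density `1/2` -/

/-- **The exact form of `(C_θ)` holds for every `θ > 1/2`**, conditionally on Freiman's lemma
(`hFreiman`, [cite: TaoVu2006, Lemma 5.13]) and on Stanchescu's theorem (`hStanchescu`,
Y. Stanchescu, Acta Arith. 83 (1998), Theorem A): for `K ≥ K₀`, every `S ⊆ [1, K]` with
`#S ≥ θ K` and every `φ : ℕ → ℂ` with no violated additive coincidence on `S` is affine on a subset
`T ⊆ S` with `#T ≥ c₀ K` (`c₀ = θ / (s - 1)`, `s = ⌊θ / (2θ - 1)⌋ + 2`).  With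
`SoloInformedHalfDensityNoAffineRigidity` (failure for every `θ ≤ 1/2`) the threshold of the exact
form of `(C_θ)` is exactly `1/2`. -/
theorem soloFS_exact_CTheta_of_gt_half
    (hFreiman : ∀ (n d : ℕ) (A : Finset (Fin n → ℝ)), 1 ≤ d →
      d ≤ Module.finrank ℝ (vectorSpan ℝ (A : Set (Fin n → ℝ))) →
      (d + 1) * A.card ≤ (A + A).card + d * (d + 1) / 2)
    (hStanchescu : ∀ s : ℕ, 1 < s → ∃ k₀ : ℕ, ∀ B : Finset (ℤ × ℤ), k₀ ≤ B.card →
      ((B + B).card : ℝ) < (4 - 2 / (s : ℝ)) * B.card - (2 * s - 1) →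
      ∃ d : ℝ × ℝ, d ≠ 0 ∧ (B.image (fun p : ℤ × ℤ => d.1 * p.2 - d.2 * p.1)).card ≤ s - 1)
    {θ : ℝ} (hθ : 1 / 2 < θ) :
    ∃ c₀ : ℝ, 0 < c₀ ∧ ∃ K₀ : ℕ, ∀ K : ℕ, K₀ ≤ K →
      ∀ S : Finset ℕ, S ⊆ Finset.Icc 1 K → θ * K ≤ (S.card : ℝ) →
        ∀ φ : ℕ → ℂ,
          (∀ a ∈ S, ∀ b ∈ S, ∀ u : ℕ, a + u ∈ S → b + u ∈ S →
            φ (a + u) - φ a = φ (b + u) - φ b) →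
            ∃ T : Finset ℕ, T ⊆ S ∧ c₀ * K ≤ (T.card : ℝ) ∧
              ∃ γ μ : ℂ, ∀ s ∈ T, φ s = γ + (s : ℂ) * μ := by
  classical
  -- ### constants
  have hθpos : 0 < θ := by linarith
  have h21 : 0 < 2 * θ - 1 := by linarith
  obtain ⟨s, hs_def⟩ : ∃ s : ℕ, s = ⌊θ / (2 * θ - 1)⌋₊ + 2 := ⟨_, rfl⟩
  have hs1 : 1 < s := by rw [hs_def]; omega
  have hs2 : (2 : ℝ) ≤ s := by exact_mod_cast (show 2 ≤ s by rw [hs_def]; omega)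
  have hs0 : (0 : ℝ) < s := by linarith
  have hsne : (s : ℝ) ≠ 0 := hs0.ne'
  have hs1' : (0 : ℝ) < (s : ℝ) - 1 := by linarith
  have hsm1 : (s : ℝ) - 1 ≠ 0 := hs1'.ne'
  have hslt : θ / (2 * θ - 1) < s := by
    have := Nat.lt_floor_add_one (θ / (2 * θ - 1))
    rw [hs_def]; push_cast; linarith
  have hθs : θ < s * (2 * θ - 1) := (div_lt_iff₀ h21).mp hslt
  obtain ⟨ε, hε_def⟩ : ∃ ε : ℝ, ε = (4 - 2 / (s : ℝ)) * θ - 2 := ⟨_, rfl⟩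
  have hεpos : 0 < ε := by
    have : ε = 2 * (s * (2 * θ - 1) - θ) / s := by
      rw [hε_def]; field_simp; ring
    rw [this]
    exact div_pos (by linarith) hs0
  have hc4 : (0 : ℝ) ≤ 4 - 2 / (s : ℝ) := by
    have : 2 / (s : ℝ) ≤ 1 := (div_le_one hs0).mpr hs2
    linarith
  obtain ⟨k₀, hk₀⟩ := hStanchescu s hs1
  refine ⟨θ / ((s : ℝ) - 1), div_pos hθpos hs1',
    ⌈(k₀ : ℝ) / θ⌉₊ + ⌈2 * (s : ℝ) / ε⌉₊ + ⌈3 / (2 * θ - 1)⌉₊ + 1, ?_⟩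
  intro K hK S hS hcard φ hex
  -- ### numeric consequences of `K ≥ K₀`
  have hK' : (⌈(k₀ : ℝ) / θ⌉₊ : ℝ) + ⌈2 * (s : ℝ) / ε⌉₊ + ⌈3 / (2 * θ - 1)⌉₊ + 1 ≤ K := by
    exact_mod_cast hK
  have hc1 := Nat.le_ceil ((k₀ : ℝ) / θ)
  have hc2 := Nat.le_ceil (2 * (s : ℝ) / ε)
  have hc3 := Nat.le_ceil (3 / (2 * θ - 1))
  have hn1 : (0 : ℝ) ≤ ⌈(k₀ : ℝ) / θ⌉₊ := Nat.cast_nonneg _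
  have hn2 : (0 : ℝ) ≤ ⌈2 * (s : ℝ) / ε⌉₊ := Nat.cast_nonneg _
  have hn3 : (0 : ℝ) ≤ ⌈3 / (2 * θ - 1)⌉₊ := Nat.cast_nonneg _
  have hKk₀ : (k₀ : ℝ) ≤ θ * K := by
    have h : (k₀ : ℝ) / θ ≤ K := by linarith
    have := (div_le_iff₀ hθpos).mp h
    linarith [mul_comm (K : ℝ) θ]
  have hKε : 2 * (s : ℝ) < ε * K := by
    have h : 2 * (s : ℝ) / ε < K := by linarith
    have := (div_lt_iff₀ hεpos).mp h
    linarith [mul_comm (K : ℝ) ε]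
  have hK3 : 3 < 2 * (θ * K) - K := by
    have h : 3 / (2 * θ - 1) < K := by linarith
    have := (div_lt_iff₀ h21).mp h
    have e : (K : ℝ) * (2 * θ - 1) = 2 * (θ * K) - K := by ring
    linarith
  have hK1 : 1 ≤ K := by
    have : (1 : ℝ) ≤ K := by linarith
    exact_mod_cast this
  have hKpos : (0 : ℝ) < K := by exact_mod_cast hK1
  -- ### the sumset of `S` and a base point
  have hN : (S + S).card + 1 ≤ 2 * K := soloFS_card_add_self_le hS hK1
  have hNR : ((S + S).card : ℝ) ≤ 2 * K - 1 := by
    have : ((S + S).card : ℝ) + 1 ≤ 2 * K := by exact_mod_cast hN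
    linarith
  have hSpos : 0 < S.card := by
    have : (0 : ℝ) < S.card := lt_of_lt_of_le (mul_pos hθpos hKpos) hcard
    exact_mod_cast this
  obtain ⟨s₀, hs₀⟩ := Finset.card_pos.mp hSpos
  -- ### the graph map and its translate
  obtain ⟨g, hgdef⟩ : ∃ g : ℕ → ℚ × ℂ, ∀ n, g n = ((n : ℚ), φ n) := ⟨_, fun _ => rfl⟩
  have hg : ∀ a ∈ S, ∀ b ∈ S, ∀ c ∈ S, ∀ d ∈ S, a + b = c + d →
      g a + g b = g c + g d := by
    intro a ha b hb c hc d hd h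
    rw [hgdef, hgdef, hgdef, hgdef]
    refine Prod.ext ?_ ?_
    · simp only [Prod.fst_add]; exact_mod_cast h
    · simp only [Prod.snd_add]; exact soloFS_sum_eq_of_exact hex ha hb hc hd h
  obtain ⟨v, hvdef⟩ : ∃ v : ℕ → ℚ × ℂ, ∀ n, v n = g n - g s₀ := ⟨_, fun _ => rfl⟩
  have hv : ∀ a ∈ S, ∀ b ∈ S, ∀ c ∈ S, ∀ d ∈ S, a + b = c + d →
      v a + v b = v c + v d := by
    intro a ha b hb c hc d hd h
    have := hg a ha b hb c hc d hd h
    rw [hvdef, hvdef, hvdef, hvdef]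
    linear_combination this
  have hvinj : Set.InjOn v S := by
    intro a ha b hb h
    have h1 := congrArg Prod.fst h
    rw [hvdef, hvdef, hgdef a, hgdef b] at h1
    simp only [Prod.fst_sub] at h1
    have : (a : ℚ) = b := by linarith
    exact_mod_cast this
  have hvmem : ∀ a ∈ S, v a ∈ Submodule.span ℚ ((S.image v : Finset (ℚ × ℂ)) : Set (ℚ × ℂ)) :=
    fun a ha => Submodule.subset_span (by
      rw [Finset.coe_image]; exact Set.mem_image_of_mem v (Finset.mem_coe.mpr ha))
  have hYcard : (S.image v).card = S.card := Finset.card_image_of_injOn hvinj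
  have h0Y : (0 : ℚ × ℂ) ∈ S.image v :=
    Finset.mem_image.mpr ⟨s₀, hs₀, by rw [hvdef, sub_self]⟩
  have hYY : (S.image v + S.image v).card ≤ (S + S).card :=
    soloFS_card_image_add_image_le S v hv
  haveI hfin : Module.Finite ℚ (Submodule.span ℚ ((S.image v : Finset (ℚ × ℂ)) : Set (ℚ × ℂ))) :=
    FiniteDimensional.span_of_finite ℚ (S.image v).finite_toSet
  obtain ⟨r, hr⟩ : ∃ r : ℕ,
      Module.finrank ℚ (Submodule.span ℚ ((S.image v : Finset (ℚ × ℂ)) : Set (ℚ × ℂ))) = r :=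
    ⟨_, rfl⟩
  rcases (show r ≤ 1 ∨ r = 2 ∨ 3 ≤ r by omega) with hr1 | hr2 | hr3
  · -- ### rank ≤ 1: the graph is collinear, `φ` is affine on all of `S`
    have hle : Module.finrank ℚ
        (Submodule.span ℚ ((S.image v : Finset (ℚ × ℂ)) : Set (ℚ × ℂ))) ≤ 1 := by
      rw [hr]; exact hr1
    obtain ⟨u₀, hu₀⟩ := finrank_le_one_iff.mp hle
    refine ⟨S, subset_rfl, ?_, ?_⟩
    · have h1 : θ / ((s : ℝ) - 1) ≤ θ := div_le_self hθpos.le (by linarith)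
      have h2 : θ / ((s : ℝ) - 1) * K ≤ θ * K := mul_le_mul_of_nonneg_right h1 hKpos.le
      linarith
    · refine soloFS_affine_of_param (g s₀) (u₀ : ℚ × ℂ) (fun a ha => ?_)
      obtain ⟨c, hc⟩ := hu₀ ⟨v a, hvmem a ha⟩
      refine ⟨c, ?_⟩
      have hc' := congrArg Subtype.val hc
      simp only [Submodule.coe_smul] at hc'
      rw [hvdef, hgdef a] at hc'
      rw [hc']
      abel
  · -- ### rank 2: integer model in `ℤ²`, Stanchescu's theorem, a popular line
    obtain ⟨w₀, w₁, z, hzdec, hzadd⟩ := soloFS_plane_coords S v (by rw [hr]; exact hr2)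
    have hzinj : Set.InjOn z S := by
      intro a ha b hb h
      apply hvinj ha hb
      rw [hzdec a ha, hzdec b hb, h]
    have hBcard : (S.image z).card = S.card := Finset.card_image_of_injOn hzinj
    have hzadd' : ∀ a ∈ S, ∀ b ∈ S, ∀ c ∈ S, ∀ d ∈ S, a + b = c + d →
        z a + z b = z c + z d :=
      fun a ha b hb c hc d hd h => hzadd a ha b hb c hc d hd (hv a ha b hb c hc d hd h)
    have hBB : (S.image z + S.image z).card ≤ (S + S).card :=
      soloFS_card_image_add_image_le S z hzadd'
    have hk₀B : k₀ ≤ (S.image z).card := by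
      rw [hBcard]
      have : (k₀ : ℝ) ≤ S.card := hKk₀.trans hcard
      exact_mod_cast this
    have hdoub : ((S.image z + S.image z).card : ℝ)
        < (4 - 2 / (s : ℝ)) * (S.image z).card - (2 * s - 1) := by
      rw [hBcard]
      have h1 : ((S.image z + S.image z).card : ℝ) ≤ (S + S).card := by exact_mod_cast hBB
      have h2 : (4 - 2 / (s : ℝ)) * (θ * K) ≤ (4 - 2 / (s : ℝ)) * S.card :=
        mul_le_mul_of_nonneg_left hcard hc4
      have h3 : ε * K = (4 - 2 / (s : ℝ)) * (θ * K) - 2 * K := by rw [hε_def]; ring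
      linarith
    obtain ⟨d, hd, hlines⟩ := hk₀ (S.image z) hk₀B hdoub
    -- pigeonhole over the at most `s - 1` lines
    have hmaps : ∀ a ∈ S, d.1 * ((z a).2 : ℝ) - d.2 * ((z a).1 : ℝ)
        ∈ (S.image z).image (fun p : ℤ × ℤ => d.1 * p.2 - d.2 * p.1) := fun a ha =>
      Finset.mem_image_of_mem (fun p : ℤ × ℤ => d.1 * p.2 - d.2 * p.1)
        (Finset.mem_image_of_mem z ha)
    have htne : ((S.image z).image (fun p : ℤ × ℤ => d.1 * p.2 - d.2 * p.1)).Nonempty :=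
      ⟨_, hmaps s₀ hs₀⟩
    have ht1 : ((S.image z).image (fun p : ℤ × ℤ => d.1 * p.2 - d.2 * p.1)).card + 1 ≤ s := by
      omega
    have ht1R : ((((S.image z).image (fun p : ℤ × ℤ => d.1 * p.2 - d.2 * p.1)).card : ℕ) : ℝ)
        + 1 ≤ s := by exact_mod_cast ht1
    have hSnn : (0 : ℝ) ≤ S.card := Nat.cast_nonneg _
    obtain ⟨y, -, hTcard⟩ := Finset.exists_le_card_fiber_of_nsmul_le_card_of_maps_to
      (f := fun a : ℕ => d.1 * ((z a).2 : ℝ) - d.2 * ((z a).1 : ℝ))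
      (b := (S.card : ℝ) / ((s : ℝ) - 1)) hmaps htne (by
        rw [nsmul_eq_mul]
        calc ((((S.image z).image (fun p : ℤ × ℤ => d.1 * p.2 - d.2 * p.1)).card : ℕ) : ℝ)
              * ((S.card : ℝ) / ((s : ℝ) - 1))
            ≤ ((s : ℝ) - 1) * ((S.card : ℝ) / ((s : ℝ) - 1)) :=
              mul_le_mul_of_nonneg_right (by linarith) (div_nonneg hSnn hs1'.le)
          _ = S.card := by rw [← mul_div_assoc, mul_div_cancel_left₀ _ hsm1])
    obtain ⟨T, hTS, hTlev, hTc⟩ : ∃ T : Finset ℕ, T ⊆ S ∧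
        (∀ a ∈ T, d.1 * ((z a).2 : ℝ) - d.2 * ((z a).1 : ℝ) = y) ∧
        (S.card : ℝ) / ((s : ℝ) - 1) ≤ T.card :=
      ⟨_, Finset.filter_subset _ _, fun a ha => (Finset.mem_filter.mp ha).2, hTcard⟩
    refine ⟨T, hTS, ?_, ?_⟩
    · calc θ / ((s : ℝ) - 1) * K = θ * K / ((s : ℝ) - 1) := by ring
        _ ≤ (S.card : ℝ) / ((s : ℝ) - 1) := div_le_div_of_nonneg_right hcard hs1'.le
        _ ≤ T.card := hTc
    · obtain ⟨c, u, hcu⟩ := soloFS_param_of_level T v z w₀ w₁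
        (fun a ha => hzdec a (hTS ha)) hd
        (fun a ha a' ha' => by rw [hTlev a ha, hTlev a' ha'])
      refine soloFS_affine_of_param (g s₀ + c) u (fun a ha => ?_)
      obtain ⟨t, ht⟩ := hcu a ha
      refine ⟨t, ?_⟩
      rw [hvdef, hgdef a] at ht
      rw [add_assoc, ← ht]
      abel
  · -- ### rank ≥ 3: impossible by Freiman's lemma
    exfalso
    have h4 := soloFS_rank_three_bound hFreiman (S.image v) h0Y (by rw [hr]; exact hr3)
    rw [hYcard] at h4
    have h5 : (4 : ℝ) * S.card ≤ 2 * K + 5 := by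
      have h' : 4 * S.card ≤ 2 * K + 5 := by omega
      exact_mod_cast h'
    linarith

end Summit.Schanuel.Schanuel.Theorems
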